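import Mathlib
import HarnessLib
import Summits.HubbardSuperconductivity.HubbardSuperconductivity.Theorems.FunctionFieldCertificateWindowInfraredBoundEngineC

/-!
# Crux `WindowInfraredBound` (stmt-HubbardSuperconductivity-1089) — the energy-form line's two physics stubs imply the
# single Goldstone-shape hypothesis

Line `pair-gaussian-domination-energy-form` (`Cruxes/WindowInfraredBound/Lines/pair_gaussian_domination_energy_form.lean`).
The landed engine C (`wib_of_pairGaussianDomination_of_chargingFloor`, p100316) composes the line's two OPEN physics stubs —
(GD) = C⁺_λ (`stub_pairGaussianDomination`, the `λ_q`-regularised own-bottom energy-form pair-channel Gaussian domination) and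
(Ch) (`stub_chargingFloor`, the charging floor `pairGap ≥ −κ/L`) — straight to the crux. This file factors that composition
through the hypothesis of the landed `wib_of_goldstoneShape`: `goldstoneShape_of_pairGaussianDomination_of_chargingFloor` proves
(GD) → (Ch) → (GS), where (GS) is VERBATIM the pointwise Goldstone-shape hypothesis
`S_ψ(m)·|q_m| ≤ A` on `0 < |q_m| ≤ ε₀` for every normalised `(N_L, 0)`-sector ground state, eventually in even `L`, for all
`U > 0`, `δ ∈ (0,1/2)`. So (GS) is formally WEAKER than the conjunction of the line's stubs (and closes the crux in one line,
`wib_of_goldstoneShape`, with `C = 32A`): it is the natural single statement to promote when the line's stubs are promoted to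
named open items (lead c2 verdict, `Cruxes/WindowInfraredBound/NOTES.md` §9). `wib_of_goldstoneShape_of_pgd` re-derives engine C
through it (consistency check). No definition, no named fact, nothing here claims (GD), (Ch) or (GS).

Sources: Kennedy–Lieb–Shastry, PRL 61 (1988) 2582 (Gaussian domination ⇒ infrared bound, shape); Pitaevskii–Stringari,
J. Low Temp. Phys. 85 (1991) 377 (moment inequality).
-/

namespace Summit.HubbardSuperconductivity.HubbardSuperconductivity.Theorems.WindowInfraredBound

-- summit = problem name (single-conjunct summit, D-0017): `HubbardSuperconductivity` occurs twice in the path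
set_option linter.dupNamespace false

open Literature.MathematicalPhysics.QuantumLattice Literature.Probability.LatticeModels Matrix Finset
open scoped ComplexOrder ComplexConjugate
open Summit.HubbardSuperconductivity.HubbardSuperconductivity.Theses

/-- **(GD) ∧ (Ch) ⇒ (GS).** The line's two physics stubs — C⁺_λ (`stub_pairGaussianDomination`, verbatim) and the charging
floor (`stub_chargingFloor`, verbatim) — imply the pointwise Goldstone shape, VERBATIM the hypothesis of `wib_of_goldstoneShape`:
for all `U > 0`, `δ ∈ (0,1/2)` there are `A ≥ 0`, `ε₀ > 0`, `L₀` with `S_ψ(m)·|q_m| ≤ A` for every even `L ≥ L₀`, every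
normalised `(N_L,0)`-sector ground state `ψ` and every `0 < |q_m| ≤ ε₀` (here `ε₀ = η` and
`A = 2√((C₁ + C₃C₂)C_χ) + 2κC_χ/π + 2c₀C_χη` from the landed budgets F1/F2/F3, first variation p96685 and regularised closure
p96461). Kennedy–Lieb–Shastry (1988); Pitaevskii–Stringari (1991). [folklore] -/
theorem goldstoneShape_of_pairGaussianDomination_of_chargingFloor :
    (∀ U : ℝ, 0 < U → ∀ δ ∈ Set.Ioo (0:ℝ) (1 / 2), ∃ C_χ c₀ η : ℝ, 0 ≤ C_χ ∧ 0 ≤ c₀ ∧ 0 < η ∧ ∃ L₀ : ℕ,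
        ∀ (L : ℕ) [NeZero L], L₀ ≤ L → Even L → ∀ m : TorusSite 2 L, m ≠ 0 → momentumNormSq L m ≤ η ^ 2 →
          ∀ t : ℝ,
            ((hubbardTorus 2 L 1 U).minEnergyOn (szSector (2 * ⌊(1 - δ) * (L : ℝ) ^ 2 / 2⌋₊) 0) -
                ((hubbardTorus 2 L 1 U).minEnergyOn (szSector (2 * ⌊(1 - δ) * (L : ℝ) ^ 2 / 2⌋₊) 0) -
                    (hubbardTorus 2 L 1 U).minEnergyOn (szSector (2 * ⌊(1 - δ) * (L : ℝ) ^ 2 / 2⌋₊ - 2) 0) +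
                    c₀ * momentumNormSq L m) / 2 * ((2 * ⌊(1 - δ) * (L : ℝ) ^ 2 / 2⌋₊ : ℕ) : ℝ) -
                C_χ * (L : ℝ) ^ 2 / momentumNormSq L m * t ^ 2 ≤
              (hubbardTorus 2 L 1 U -
                ((((hubbardTorus 2 L 1 U).minEnergyOn (szSector (2 * ⌊(1 - δ) * (L : ℝ) ^ 2 / 2⌋₊) 0) -
                    (hubbardTorus 2 L 1 U).minEnergyOn (szSector (2 * ⌊(1 - δ) * (L : ℝ) ^ 2 / 2⌋₊ - 2) 0) +
                    c₀ * momentumNormSq L m) / 2 : ℝ) : ℂ) •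
                  (totalNumber : Matrix (Finset (Orb (FermionTorus 2 L))) (Finset (Orb (FermionTorus 2 L))) ℂ) -
                (t : ℂ) • (pairFieldAt dWaveFormFactor L m + (pairFieldAt dWaveFormFactor L m)ᴴ)).minEnergyOn
                (szSector (2 * ⌊(1 - δ) * (L : ℝ) ^ 2 / 2⌋₊ - 2) 0 ⊔
                  szSector (2 * ⌊(1 - δ) * (L : ℝ) ^ 2 / 2⌋₊) 0)) ∧
            ((hubbardTorus 2 L 1 U).minEnergyOn (szSector (2 * ⌊(1 - δ) * (L : ℝ) ^ 2 / 2⌋₊) 0) -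
                ((hubbardTorus 2 L 1 U).minEnergyOn (szSector (2 * ⌊(1 - δ) * (L : ℝ) ^ 2 / 2⌋₊ + 2) 0) -
                    (hubbardTorus 2 L 1 U).minEnergyOn (szSector (2 * ⌊(1 - δ) * (L : ℝ) ^ 2 / 2⌋₊) 0) -
                    c₀ * momentumNormSq L m) / 2 * ((2 * ⌊(1 - δ) * (L : ℝ) ^ 2 / 2⌋₊ : ℕ) : ℝ) -
                C_χ * (L : ℝ) ^ 2 / momentumNormSq L m * t ^ 2 ≤
              (hubbardTorus 2 L 1 U -
                ((((hubbardTorus 2 L 1 U).minEnergyOn (szSector (2 * ⌊(1 - δ) * (L : ℝ) ^ 2 / 2⌋₊ + 2) 0) -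
                    (hubbardTorus 2 L 1 U).minEnergyOn (szSector (2 * ⌊(1 - δ) * (L : ℝ) ^ 2 / 2⌋₊) 0) -
                    c₀ * momentumNormSq L m) / 2 : ℝ) : ℂ) •
                  (totalNumber : Matrix (Finset (Orb (FermionTorus 2 L))) (Finset (Orb (FermionTorus 2 L))) ℂ) -
                (t : ℂ) • (pairFieldAt dWaveFormFactor L m + (pairFieldAt dWaveFormFactor L m)ᴴ)).minEnergyOn
                (szSector (2 * ⌊(1 - δ) * (L : ℝ) ^ 2 / 2⌋₊) 0 ⊔
                  szSector (2 * ⌊(1 - δ) * (L : ℝ) ^ 2 / 2⌋₊ + 2) 0))) →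
    (∀ U : ℝ, 0 < U → ∀ δ ∈ Set.Ioo (0:ℝ) (1 / 2), ∃ κ : ℝ, 0 ≤ κ ∧ ∃ L₀ : ℕ, ∀ (L : ℕ) [NeZero L],
        L₀ ≤ L → Even L → -(κ / (L : ℝ)) ≤ pairGap (hubbardTorus 2 L 1 U) (2 * ⌊(1 - δ) * (L : ℝ) ^ 2 / 2⌋₊)) →
    ∀ U : ℝ, 0 < U → ∀ δ ∈ Set.Ioo (0:ℝ) (1 / 2), ∃ A ε₀ : ℝ, 0 ≤ A ∧ 0 < ε₀ ∧ ∃ L₀ : ℕ,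
      ∀ (L : ℕ) [NeZero L], L₀ ≤ L → Even L → ∀ ψ : Fock (Orb (FermionTorus 2 L)),
        star ψ ⬝ᵥ ψ = 1 →
          IsGroundStateInSector (hubbardTorus 2 L 1 U) (2 * ⌊(1 - δ) * (L : ℝ) ^ 2 / 2⌋₊) 0 ψ →
            ∀ m : TorusSite 2 L, m ≠ 0 → momentumNormSq L m ≤ ε₀ ^ 2 →
              pairStructureFactor dWaveFormFactor L ψ m * Real.sqrt (momentumNormSq L m) ≤ A := by
  intro hGD hCh U hU δ hδ
  obtain ⟨C_X, c₀, η, hCX, hc₀, hη, L₁, hGD⟩ := hGD U hU δ hδ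
  obtain ⟨κ, hκ, L₂, hCh⟩ := hCh U hU δ hδ
  obtain ⟨C₃, hC₃, L₃, hF3⟩ := wib_twoParticleCost_holds U hU δ hδ
  obtain ⟨C, hC, hB⟩ := stub_doubleCommBound U hU
  obtain ⟨B, hB0, hPCB⟩ := WcbcsSsbToTorusLRO.stub_pairCommutatorBudget
  refine ⟨2 * Real.sqrt ((C + C₃ * B) * C_X) + 2 * κ * C_X / Real.pi + 2 * c₀ * C_X * η, η,
    by positivity, hη, max (max L₁ L₂) (max L₃ 2), fun L _ hL₀ hev ψ hψ1 hψ m hm0 hmη => ?_⟩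
  have hL₁ : L₁ ≤ L := le_trans (le_max_left _ _) ((le_max_left _ _).trans hL₀)
  have hL₂ : L₂ ≤ L := le_trans (le_max_right _ _) ((le_max_left _ _).trans hL₀)
  have hL₃ : L₃ ≤ L := le_trans (le_max_left _ _) ((le_max_right _ _).trans hL₀)
  have hL2 : 2 ≤ L := le_trans (le_max_right _ _) ((le_max_right _ _).trans hL₀)
  have hN : 2 ≤ 2 * ⌊(1 - δ) * (L : ℝ) ^ 2 / 2⌋₊ := wib_two_le_summitFilling hδ hL2
  -- C⁺_λ at this `L`, `m`, all `t`; first variation (p96685) ⇒ (T_λ∓)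
  have hGD' := hGD L hL₁ hev m hm0 hmη
  obtain ⟨hTm, hTp⟩ := stub_pgdFirstVariation L U (2 * ⌊(1 - δ) * (L : ℝ) ^ 2 / 2⌋₊) hN ψ hψ hψ1 m
    (C_X * (L : ℝ) ^ 2 / momentumNormSq L m) (c₀ * momentumNormSq L m)
  have hTm' := hTm (fun t => (hGD' t).1)
  have hTp' := hTp (fun t => (hGD' t).2)
  -- (F1) at `μ = 0`
  have hF1 : (star ψ ⬝ᵥ (((pairFieldAt dWaveFormFactor L m)ᴴ *
        (hubbardTorus 2 L 1 U * pairFieldAt dWaveFormFactor L m -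
          pairFieldAt dWaveFormFactor L m * hubbardTorus 2 L 1 U) -
        (hubbardTorus 2 L 1 U * pairFieldAt dWaveFormFactor L m -
          pairFieldAt dWaveFormFactor L m * hubbardTorus 2 L 1 U) *
        (pairFieldAt dWaveFormFactor L m)ᴴ) *ᵥ ψ)).re ≤ C * (L : ℝ) ^ 2 := by
    have h := hB L 0 m ψ
    rw [hubbardTorusWith_zero, hψ1, Complex.one_re, mul_one, abs_zero, add_zero, mul_one] at h
    exact (le_abs_self _).trans h
  -- (F2)
  have hF2 : |(star ψ ⬝ᵥ (((pairFieldAt dWaveFormFactor L m)ᴴ * pairFieldAt dWaveFormFactor L m -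
        pairFieldAt dWaveFormFactor L m * (pairFieldAt dWaveFormFactor L m)ᴴ) *ᵥ ψ)).re| ≤
        B * (L : ℝ) ^ 2 := by
    have h := hPCB L m ψ
    rwa [hψ1, Complex.one_re, mul_one] at h
  exact goldstoneShape_of_regularisedClosure hN hψ hψ1 hm0 hCX hC hB0 hC₃ hκ hc₀ hmη hη
    hTm' hTp' hF1 hF2 (hF3 L hL₃ hev) (hCh L hL₂ hev)

/-- **Consistency check: engine C factors through (GS).** `wib_of_goldstoneShape ∘ goldstoneShape_of_pairGaussianDomination_of_chargingFloor`
re-derives the landed `wib_of_pairGaussianDomination_of_chargingFloor` (p100316): (GD) → (Ch) → `WindowInfraredBound`. [folklore] -/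
theorem wib_of_goldstoneShape_of_pgd
    (hGD : ∀ U : ℝ, 0 < U → ∀ δ ∈ Set.Ioo (0:ℝ) (1 / 2), ∃ C_χ c₀ η : ℝ, 0 ≤ C_χ ∧ 0 ≤ c₀ ∧ 0 < η ∧ ∃ L₀ : ℕ,
        ∀ (L : ℕ) [NeZero L], L₀ ≤ L → Even L → ∀ m : TorusSite 2 L, m ≠ 0 → momentumNormSq L m ≤ η ^ 2 →
          ∀ t : ℝ,
            ((hubbardTorus 2 L 1 U).minEnergyOn (szSector (2 * ⌊(1 - δ) * (L : ℝ) ^ 2 / 2⌋₊) 0) -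
                ((hubbardTorus 2 L 1 U).minEnergyOn (szSector (2 * ⌊(1 - δ) * (L : ℝ) ^ 2 / 2⌋₊) 0) -
                    (hubbardTorus 2 L 1 U).minEnergyOn (szSector (2 * ⌊(1 - δ) * (L : ℝ) ^ 2 / 2⌋₊ - 2) 0) +
                    c₀ * momentumNormSq L m) / 2 * ((2 * ⌊(1 - δ) * (L : ℝ) ^ 2 / 2⌋₊ : ℕ) : ℝ) -
                C_χ * (L : ℝ) ^ 2 / momentumNormSq L m * t ^ 2 ≤
              (hubbardTorus 2 L 1 U -
                ((((hubbardTorus 2 L 1 U).minEnergyOn (szSector (2 * ⌊(1 - δ) * (L : ℝ) ^ 2 / 2⌋₊) 0) -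
                    (hubbardTorus 2 L 1 U).minEnergyOn (szSector (2 * ⌊(1 - δ) * (L : ℝ) ^ 2 / 2⌋₊ - 2) 0) +
                    c₀ * momentumNormSq L m) / 2 : ℝ) : ℂ) •
                  (totalNumber : Matrix (Finset (Orb (FermionTorus 2 L))) (Finset (Orb (FermionTorus 2 L))) ℂ) -
                (t : ℂ) • (pairFieldAt dWaveFormFactor L m + (pairFieldAt dWaveFormFactor L m)ᴴ)).minEnergyOn
                (szSector (2 * ⌊(1 - δ) * (L : ℝ) ^ 2 / 2⌋₊ - 2) 0 ⊔
                  szSector (2 * ⌊(1 - δ) * (L : ℝ) ^ 2 / 2⌋₊) 0)) ∧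
            ((hubbardTorus 2 L 1 U).minEnergyOn (szSector (2 * ⌊(1 - δ) * (L : ℝ) ^ 2 / 2⌋₊) 0) -
                ((hubbardTorus 2 L 1 U).minEnergyOn (szSector (2 * ⌊(1 - δ) * (L : ℝ) ^ 2 / 2⌋₊ + 2) 0) -
                    (hubbardTorus 2 L 1 U).minEnergyOn (szSector (2 * ⌊(1 - δ) * (L : ℝ) ^ 2 / 2⌋₊) 0) -
                    c₀ * momentumNormSq L m) / 2 * ((2 * ⌊(1 - δ) * (L : ℝ) ^ 2 / 2⌋₊ : ℕ) : ℝ) -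
                C_χ * (L : ℝ) ^ 2 / momentumNormSq L m * t ^ 2 ≤
              (hubbardTorus 2 L 1 U -
                ((((hubbardTorus 2 L 1 U).minEnergyOn (szSector (2 * ⌊(1 - δ) * (L : ℝ) ^ 2 / 2⌋₊ + 2) 0) -
                    (hubbardTorus 2 L 1 U).minEnergyOn (szSector (2 * ⌊(1 - δ) * (L : ℝ) ^ 2 / 2⌋₊) 0) -
                    c₀ * momentumNormSq L m) / 2 : ℝ) : ℂ) •
                  (totalNumber : Matrix (Finset (Orb (FermionTorus 2 L))) (Finset (Orb (FermionTorus 2 L))) ℂ) -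
                (t : ℂ) • (pairFieldAt dWaveFormFactor L m + (pairFieldAt dWaveFormFactor L m)ᴴ)).minEnergyOn
                (szSector (2 * ⌊(1 - δ) * (L : ℝ) ^ 2 / 2⌋₊) 0 ⊔
                  szSector (2 * ⌊(1 - δ) * (L : ℝ) ^ 2 / 2⌋₊ + 2) 0)))
    (hCh : ∀ U : ℝ, 0 < U → ∀ δ ∈ Set.Ioo (0:ℝ) (1 / 2), ∃ κ : ℝ, 0 ≤ κ ∧ ∃ L₀ : ℕ, ∀ (L : ℕ) [NeZero L],
        L₀ ≤ L → Even L → -(κ / (L : ℝ)) ≤ pairGap (hubbardTorus 2 L 1 U) (2 * ⌊(1 - δ) * (L : ℝ) ^ 2 / 2⌋₊)) :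
    FunctionFieldCertificate.WindowInfraredBound :=
  wib_of_goldstoneShape (goldstoneShape_of_pairGaussianDomination_of_chargingFloor hGD hCh)

end Summit.HubbardSuperconductivity.HubbardSuperconductivity.Theorems.WindowInfraredBound
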